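import Summits.ResolutionOfSingularities.ResolutionOfSingularities.Theorems.RadicialJungCleanModelsSufficeGameLocal

/-!
# Route `RadicialJung`, crux `CleanModelsSuffice`, line `Sketch`: the PHASE-2 CENTRE of the
# exceptionalisation game is closed and admissible (`stub_gameCentre2`)

The registered stub `stub_gameCentre2` of the skeleton of
`Summit.ResolutionOfSingularities.ResolutionOfSingularities.Theses.RadicialJung.CleanModelsSuffice`
(stmt-ResolutionOfSingularities-15883). In PHASE 2 of the game (`mOld ≤ 1` everywhere) the centre attached
to an exceptional divisor `D₀ ∈ E` is its BAD LOCUS `W D₀ = {v | mOld v = 1 ∧ D₀ charged at v}`; it is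
blown up along the two coordinates `oldCh v ∪ {lab_v D₀}` at each of its points. This file proves that
`W D₀` is closed and admissible:

* `GameState.LocalDescr` — the LOCAL DESCRIPTIONS of a game state near `v` (for an abstract family of
  generisations `gen v t`; in the application `gen = GameState.gen`, `…GameCount`): nearby exceptional
  divisors pass through `v` with the same charge (`…GameCharge`), `w ∈ D ↔ gen v {lab_v D} ⤳ w`, the
  count `mOld w = #{i ∈ oldCh v | gen v {i} ⤳ w}` in the intrinsic regime (`…GameLocal`, (E)+(F)), and
  `gen v t ⤳ w ↔ ∀ i ∈ t, gen v {i} ⤳ w`;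
* `GameState.W_local` — near `v ∈ W D₀` the bad locus is the closure of `gen v (oldCh v ∪ {lab_v D₀})`,
  near `v ∉ W D₀` it is empty; `GameState.isClosed_W_of_local`, `GameState.admissible_W_of_local`;
* `GameState.exists_localDescr` — the local descriptions hold for `GameState.gen`;
* `stub_gameCentre2` — the registered stub (with `L` made a `K(V)`-algebra along the birational `π`).
-/

noncomputable section

set_option linter.dupNamespace false -- mandated namespace of this single-conjunct summit

open CategoryTheory AlgebraicGeometry TopologicalSpace IsLocalRing
open Literature.AlgebraicGeometry.Resolution Literature.AlgebraicGeometry.Motives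
open Summit.ResolutionOfSingularities.ResolutionOfSingularities.Theorems.Picover

namespace Summit.ResolutionOfSingularities.ResolutionOfSingularities.Theorems.RadicialJung.CleanModelsSuffice

attribute [local instance] stalkAlgebra isScalarTower_stalkAlgebra

namespace GameState


variable {p : ℕ} {V₀ : Scheme.{0}} [IsIntegral V₀] {L : Type} [Field L] [Algebra V₀.functionField L]
  {V : Scheme.{0}} [IsIntegral V] {π : V ⟶ V₀} [IsDominant π] (S : GameState p V₀ L V π)

open Classical in
/-- **The local descriptions of a game state near `v`** (the hypotheses of this file), for an abstract
family of generisations `gen v t`. [folklore] -/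
structure LocalDescr (gen : ∀ v : V, Finset (Fin (S.d v)) → V) (v : V) (U : V.Opens) : Prop where
  mem : v ∈ U
  support : ∀ w ∈ U, ∀ D ∈ S.E, w ∈ D.support → v ∈ D.support
  charge : ∀ w ∈ U, ∀ D ∈ S.E, w ∈ D.support → (S.chargedAt D w ↔ S.chargedAt D v)
  support_iff : ∀ w ∈ U, ∀ (D : V.IdealSheafData) (hD : D ∈ S.E ∧ v ∈ D.support),
    w ∈ D.support ↔ gen v {S.lab v ⟨D, hD⟩} ⤳ w
  mOld_eq : ∀ w ∈ U, (2 ≤ (S.ch w).card ∨ 2 ≤ ((S.ch v).filter fun i => gen v {i} ⤳ w).card) →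
    S.mOld w = ((S.oldCh v).filter fun i => gen v {i} ⤳ w).card
  gen_iff : ∀ w ∈ U, ∀ t : Finset (Fin (S.d v)), gen v t ⤳ w ↔ ∀ i ∈ t, gen v {i} ⤳ w

/-- Membership in `oldCh`. [folklore] -/
theorem mem_oldCh_iff (v : V) (i : Fin (S.d v)) : i ∈ S.oldCh v ↔ S.a v i ≠ 0 ∧ ¬ S.IsLab v i := by
  simp [GameState.oldCh, GameState.ch]

variable {S}

/-- The label of a charged divisor is a charged, labelled coordinate. [folklore] -/
theorem lab_mem_ch_of_chargedAt {D : V.IdealSheafData} {v : V} (h : S.chargedAt D v) :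
    S.lab v ⟨D, S.mem_E_of_chargedAt h, S.mem_support_of_chargedAt h⟩ ∈ S.ch v := by
  rw [S.mem_ch_iff]
  obtain ⟨h', ha⟩ := (S.chargedAt_iff D v).mp h
  exact ha

/-- A point with `mOld w = 1` and a charged exceptional divisor has at least two charged coordinates.
[folklore] -/
theorem two_le_card_ch {D : V.IdealSheafData} {w : V} (hm : S.mOld w = 1) (h : S.chargedAt D w) :
    2 ≤ (S.ch w).card := by
  classical
  obtain ⟨i₀, hi₀⟩ := Finset.card_eq_one.mp hm
  have hi₀mem : i₀ ∈ S.oldCh w := by rw [hi₀]; exact Finset.mem_singleton_self _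
  rw [S.mem_oldCh_iff] at hi₀mem
  set i₁ := S.lab w ⟨D, S.mem_E_of_chargedAt h, S.mem_support_of_chargedAt h⟩ with hi₁
  have hi₁ch : i₁ ∈ S.ch w := lab_mem_ch_of_chargedAt h
  have hne : i₀ ≠ i₁ := fun heq => hi₀mem.2 ⟨_, heq.symm⟩
  have hsub : ({i₀, i₁} : Finset _) ⊆ S.ch w := by
    intro i hi
    rcases Finset.mem_insert.mp hi with rfl | hi
    · exact (S.mem_ch_iff w _).mpr hi₀mem.1
    · rw [Finset.mem_singleton.mp hi]; exact hi₁ch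
  calc 2 = ({i₀, i₁} : Finset _).card := (Finset.card_pair hne).symm
    _ ≤ (S.ch w).card := Finset.card_le_card hsub

variable (S)

/-- **The local form of the bad locus.** Under the local descriptions near `v`: if `v ∈ W D₀` then near
`v` the bad locus is the closure of `gen v (oldCh v ∪ {lab_v D₀})`; otherwise it is empty near `v`.
[folklore] -/
theorem W_local {gen : ∀ v : V, Finset (Fin (S.d v)) → V} (h1 : ∀ v, S.mOld v ≤ 1)
    (D₀ : V.IdealSheafData) (hD₀ : D₀ ∈ S.E) {v : V} {U : V.Opens} (hU : S.LocalDescr gen v U) :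
    (∃ hv : v ∈ S.W D₀, ∀ w ∈ U, w ∈ S.W D₀ ↔
        gen v (S.oldCh v ∪ {S.lab v ⟨D₀, hD₀, S.mem_support_of_chargedAt hv.2⟩}) ⤳ w) ∨
      (∀ w ∈ U, w ∉ S.W D₀) := by
  classical
  by_cases hv : v ∈ S.W D₀
  · left
    refine ⟨hv, fun w hw => ?_⟩
    obtain ⟨hm1, hch⟩ := hv
    have hvD₀ : v ∈ D₀.support := S.mem_support_of_chargedAt hch
    obtain ⟨i₀, hi₀⟩ := Finset.card_eq_one.mp hm1
    set i₁ := S.lab v ⟨D₀, hD₀, hvD₀⟩ with hi₁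
    have hi₁ch : i₁ ∈ S.ch v := lab_mem_ch_of_chargedAt hch
    have hi₀old : i₀ ∈ S.oldCh v := by rw [hi₀]; exact Finset.mem_singleton_self _
    have hi₀ch : i₀ ∈ S.ch v := (Finset.mem_filter.mp hi₀old).1
    have hne : i₀ ≠ i₁ := fun heq => ((S.mem_oldCh_iff v i₀).mp hi₀old).2 ⟨_, heq.symm⟩
    rw [hU.gen_iff w hw]
    constructor
    · rintro ⟨hmw, hchw⟩
      have hwD₀ : w ∈ D₀.support := S.mem_support_of_chargedAt hchw
      have hg₁ : gen v {i₁} ⤳ w := (hU.support_iff w hw D₀ ⟨hD₀, hvD₀⟩).mp hwD₀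
      have hmOld := hU.mOld_eq w hw (Or.inl (two_le_card_ch hmw hchw))
      rw [hmw, hi₀, Finset.filter_singleton] at hmOld
      have hg₀ : gen v {i₀} ⤳ w := by
        by_contra hn
        rw [if_neg hn, Finset.card_empty] at hmOld
        exact one_ne_zero hmOld
      intro i hi
      rcases Finset.mem_union.mp hi with hi | hi
      · rw [hi₀, Finset.mem_singleton] at hi; rw [hi]; exact hg₀
      · rw [Finset.mem_singleton] at hi; rw [hi]; exact hg₁
    · intro hall
      have hg₀ : gen v {i₀} ⤳ w := hall i₀ (Finset.mem_union_left _ hi₀old)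
      have hg₁ : gen v {i₁} ⤳ w := hall i₁ (Finset.mem_union_right _ (Finset.mem_singleton_self _))
      have hcount : 2 ≤ ((S.ch v).filter fun i => gen v {i} ⤳ w).card := by
        have hsub : ({i₀, i₁} : Finset _) ⊆ (S.ch v).filter fun i => gen v {i} ⤳ w := by
          intro i hi
          rw [Finset.mem_filter]
          rcases Finset.mem_insert.mp hi with rfl | hi
          · exact ⟨hi₀ch, hg₀⟩
          · rw [Finset.mem_singleton.mp hi]; exact ⟨hi₁ch, hg₁⟩
        calc 2 = ({i₀, i₁} : Finset _).card := (Finset.card_pair hne).symm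
          _ ≤ _ := Finset.card_le_card hsub
      have hmOld := hU.mOld_eq w hw (Or.inr hcount)
      rw [hi₀, Finset.filter_singleton, if_pos hg₀, Finset.card_singleton] at hmOld
      have hwD₀ : w ∈ D₀.support := (hU.support_iff w hw D₀ ⟨hD₀, hvD₀⟩).mpr hg₁
      exact ⟨hmOld, (hU.charge w hw D₀ hD₀ hwD₀).mpr hch⟩
  · right
    intro w hw hwW
    obtain ⟨hmw, hchw⟩ := hwW
    have hwD₀ : w ∈ D₀.support := S.mem_support_of_chargedAt hchw
    have hvD₀ : v ∈ D₀.support := hU.support w hw D₀ hD₀ hwD₀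
    have hchv : S.chargedAt D₀ v := (hU.charge w hw D₀ hD₀ hwD₀).mp hchw
    have hm0 : S.mOld v = 0 := by
      have hle := h1 v
      rcases Nat.le_one_iff_eq_zero_or_eq_one.mp hle with h | h
      · exact h
      · exact absurd ⟨h, hchv⟩ hv
    have hold : S.oldCh v = ∅ := Finset.card_eq_zero.mp hm0
    have hmOld := hU.mOld_eq w hw (Or.inl (two_le_card_ch hmw hchw))
    rw [hmw, hold, Finset.filter_empty, Finset.card_empty] at hmOld
    exact one_ne_zero hmOld

/-- **The bad locus is closed**, given local descriptions at every point. [folklore] -/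
theorem isClosed_W_of_local {gen : ∀ v : V, Finset (Fin (S.d v)) → V} (h1 : ∀ v, S.mOld v ≤ 1)
    (D₀ : V.IdealSheafData) (hD₀ : D₀ ∈ S.E) (hloc : ∀ v, ∃ U, S.LocalDescr gen v U) :
    IsClosed (S.W D₀) := by
  rw [← isOpen_compl_iff, isOpen_iff_forall_mem_open]
  intro v hv
  obtain ⟨U, hU⟩ := hloc v
  rcases S.W_local h1 D₀ hD₀ hU with ⟨hvW, -⟩ | hempty
  · exact absurd hvW hv
  · exact ⟨U, fun w hw hwW => hempty w hw hwW, U.isOpen, hU.mem⟩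

/-- **The phase-2 centre is closed and admissible**, given the local descriptions at every point and the
stalk ideals of germs of closures of the `gen v t`. [folklore] -/
theorem admissible_W_of_local {gen : ∀ v : V, Finset (Fin (S.d v)) → V} (h1 : ∀ v, S.mOld v ≤ 1)
    (D₀ : V.IdealSheafData) (hD₀ : D₀ ∈ S.E) (hloc : ∀ v, ∃ U, S.LocalDescr gen v U)
    (hstalk : ∀ (v : V) (t : Finset (Fin (S.d v))) (Z : Set V) (hZ : IsClosed Z),
      (∃ U : V.Opens, v ∈ U ∧ ∀ w ∈ U, (w ∈ Z ↔ gen v t ⤳ w)) →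
        stalkIdeal (Scheme.IdealSheafData.vanishingIdeal ⟨Z, hZ⟩) v = Ideal.span (S.u v '' (t : Set _))) :
    ∃ hZ : IsClosed (S.W D₀), S.Admissible (S.W D₀) hZ
      (fun v hv => S.oldCh v ∪ {S.lab v ⟨D₀, hD₀, S.mem_support_of_chargedAt hv.2⟩}) := by
  classical
  refine ⟨S.isClosed_W_of_local h1 D₀ hD₀ hloc, ⟨fun v hv => ?_, fun v hv => ?_, fun v hv => ?_⟩⟩
  · -- two coordinates
    obtain ⟨hm1, hch⟩ := hv
    obtain ⟨i₀, hi₀⟩ := Finset.card_eq_one.mp hm1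
    have hi₀old : i₀ ∈ S.oldCh v := by rw [hi₀]; exact Finset.mem_singleton_self _
    have hnot : S.lab v ⟨D₀, hD₀, S.mem_support_of_chargedAt hch⟩ ∉ S.oldCh v := fun h =>
      ((S.mem_oldCh_iff v _).mp h).2 ⟨_, rfl⟩
    have hc : (S.oldCh v).card = 1 := hm1
    rw [Finset.card_union_of_disjoint (Finset.disjoint_singleton_right.mpr hnot), hc,
      Finset.card_singleton]
  · -- charged coordinates
    intro i hi
    rcases Finset.mem_union.mp hi with hi | hi
    · exact (Finset.mem_filter.mp hi).1
    · rw [Finset.mem_singleton.mp hi]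
      exact lab_mem_ch_of_chargedAt hv.2
  · -- the stalk ideal
    obtain ⟨U, hU⟩ := hloc v
    rcases S.W_local h1 D₀ hD₀ hU with ⟨hvW, hW⟩ | hempty
    · rw [hstalk v _ (S.W D₀) _ ⟨U, hU.mem, hW⟩, Finset.coe_union, Finset.coe_singleton]
    · exact absurd hv (hempty v hU.mem)


/-! ## The local descriptions hold for `GameState.gen` -/

section Instantiate

variable [Algebra V.functionField L]
  (hp : p.Prime) (k : Type) [Field k] [CharP k p] (f : V ⟶ Spec (.of k)) [LocallyOfFiniteType f]
  (hdegV : Module.finrank V.functionField L = p)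
  (hrange : Set.range (algebraMap V.functionField L) = Set.range (algebraMap V₀.functionField L))
  (hcompat : ∀ g : V₀.functionField,
    algebraMap V.functionField L (RatFn.functionFieldMap π g) = algebraMap V₀.functionField L g)

include hp f hdegV hrange hcompat in
/-- **The local descriptions of a game state hold near every point**, for the generisations
`GameState.gen` (`…GameLocal`, `…GameCount`, `…GameCharge`). [folklore] -/
theorem exists_localDescr (v : V) : ∃ U : V.Opens, S.LocalDescr S.gen v U := by
  classical
  obtain ⟨U₁, hv₁, hU₁⟩ := S.exists_nhds_chargedAt_iff_gen hp k f hdegV hrange hcompat v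
  obtain ⟨U₂, hv₂, hU₂⟩ := S.exists_nhds_mOld_eq hp k f hdegV hrange hcompat v
  have hgen : ∀ t : Finset (Fin (S.d v)), ∃ U : V.Opens, v ∈ U ∧
      ∀ w ∈ U, (S.gen v t ⤳ w ↔ ∀ i ∈ t, S.gen v {i} ⤳ w) := fun t =>
    S.exists_nhds_gen_specializes_iff k f v t
  choose U₃ hv₃ hU₃ using hgen
  let W : V.Opens := ⟨(U₁ : Set V) ∩ U₂ ∩ ⋂ t, (U₃ t : Set V),
    (U₁.isOpen.inter U₂.isOpen).inter (isOpen_iInter_of_finite fun t => (U₃ t).isOpen)⟩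
  have hmemW : ∀ w, w ∈ W ↔ w ∈ U₁ ∧ w ∈ U₂ ∧ ∀ t, w ∈ U₃ t := fun w => by
    change w ∈ ((U₁ : Set V) ∩ U₂ ∩ ⋂ t, (U₃ t : Set V)) ↔ _
    simp only [Set.mem_inter_iff, Set.mem_iInter, SetLike.mem_coe, and_assoc]
  refine ⟨W, ⟨(hmemW v).mpr ⟨hv₁, hv₂, hv₃⟩, fun w hw => (hU₁ w ((hmemW w).mp hw).1).1,
    fun w hw D hD hwD => ?_, fun w hw D hD => ((hU₁ w ((hmemW w).mp hw).1).2 D hD).1,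
    fun w hw => hU₂ w ((hmemW w).mp hw).2.1, fun w hw t => hU₃ t w (((hmemW w).mp hw).2.2 t)⟩⟩
  have hw₁ := (hmemW w).mp hw
  have hvD : v ∈ D.support := (hU₁ w hw₁.1).1 D hD hwD
  obtain ⟨hsupp, hch⟩ := (hU₁ w hw₁.1).2 D ⟨hD, hvD⟩
  rw [hch]
  exact ⟨fun h => h.1, fun h => ⟨h, hsupp.mp hwD⟩⟩

end Instantiate

end GameState

/-! ## The registered stub -/

/-- **The phase-2 centre is closed and admissible** (registered stub `stub_gameCentre2` of the line
`Sketch`): in phase 2 (`mOld ≤ 1`), for an exceptional divisor `D₀ ∈ E`, the bad locus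
`W D₀ = {mOld = 1 ∧ D₀ charged}` is closed, and at each of its points it is, near the point, the
coordinate subspace of the old charged coordinate and the coordinate labelled by `D₀` (both charged).
`L` is made a `K(V)`-algebra along the birational `π` (`K(V₀) ≅ K(V)`). [folklore] -/
theorem stub_gameCentre2 (p : ℕ) (hp : p.Prime) (k : Type) [Field k] [CharP k p]
    (V₀ : Scheme.{0}) [IsIntegral V₀] (f₀ : V₀ ⟶ Spec (.of k)) (L : Type) [Field L]
    [Algebra V₀.functionField L] [LocallyOfFiniteType f₀] [QuasiCompact f₀]
    (hdeg : Module.finrank V₀.functionField L = p)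
    (V : Scheme.{0}) [IsIntegral V] (π : V ⟶ V₀) [IsDominant π] [IsProper π] (hbir : IsBirational π)
    (S : GameState p V₀ L V π) (h1 : ∀ v, S.mOld v ≤ 1) (D₀ : V.IdealSheafData) (hD₀ : D₀ ∈ S.E) :
    ∃ hZ : IsClosed (S.W D₀), S.Admissible (S.W D₀) hZ
      (fun v hv => S.oldCh v ∪ {S.lab v ⟨D₀, hD₀, S.mem_support_of_chargedAt hv.2⟩}) := by
  classical
  -- `L` over `K(V)` along the birational `π` (as in `stub_gameCentre1`)
  have hbij : Function.Bijective (RatFn.functionFieldMap π) :=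
    TowerTransport.bijective_functionFieldMap_of_isIso π hbir.isIso_stalkMap_genericPoint
  let eK : V₀.functionField ≃+* V.functionField := RingEquiv.ofBijective _ hbij
  have heK : ∀ x, eK x = RatFn.functionFieldMap π x := fun _ => rfl
  letI : Algebra V.functionField L :=
    ((algebraMap V₀.functionField L).comp eK.symm.toRingHom).toAlgebra
  have halg : algebraMap V.functionField L =
      (algebraMap V₀.functionField L).comp eK.symm.toRingHom := rfl
  have hcompat : ∀ g : V₀.functionField,
      algebraMap V.functionField L (RatFn.functionFieldMap π g) = algebraMap V₀.functionField L g := by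
    intro g
    rw [halg, RingHom.comp_apply, ← heK]
    exact congrArg (algebraMap V₀.functionField L) (eK.symm_apply_apply g)
  have hrange : Set.range (algebraMap V.functionField L) =
      Set.range (algebraMap V₀.functionField L) := by
    ext z
    constructor
    · rintro ⟨x, rfl⟩
      exact ⟨eK.symm x, by rw [halg]; rfl⟩
    · rintro ⟨x, rfl⟩
      exact ⟨RatFn.functionFieldMap π x, hcompat x⟩
  have hdegV : Module.finrank V.functionField L = p := by
    rw [← hdeg]
    exact Algebra.finrank_eq_of_equiv_equiv eK.symm (RingEquiv.refl L) (by ext x; simp [halg])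
  let f : V ⟶ Spec (.of k) := π ≫ f₀
  haveI : LocallyOfFiniteType f := inferInstance
  haveI : IsLocallyNoetherian V := LocallyOfFiniteType.isLocallyNoetherian f
  exact S.admissible_W_of_local h1 D₀ hD₀
    (fun v => S.exists_localDescr hp k f hdegV hrange hcompat v)
    (fun v t Z hZ ⟨U, hvU, hU⟩ => S.stalkIdeal_vanishingIdeal_eq_span_of_nhds v t hZ U hvU hU)

end Summit.ResolutionOfSingularities.ResolutionOfSingularities.Theorems.RadicialJung.CleanModelsSuffice

end
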